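import Summits.NavierStokesRegularity.NavierStokesRegularity.Theorems.WakeRatchetEternalViscousRateCircuitPumpClock

/-!
# `WakeRatchet.EternalViscousRate` (stmt-NavierStokesRegularity-25647): FAR-PAST DECAY `(-t)^{-3/2}` of every
# Type-I solution of a viscous Tao circuit — the analytic core of the action clause (brick 3a of the bridge
# «`PerpetualPump.CircuitPump` witness ⟹ dissipation-balanced block-DSS bounded admissible eternal solution»)

Brick 1 (`WakeRatchetCircuitPumpClock.typeI_clock_bound`) turned the PDE-weight Type-I bound `lam^{3n/5}|X| ≤ C/√(-t)`
into the lattice clock `lam^{n}(-t)|X| ≤ K`.  Feeding BOTH bounds back into the quadratic forcing (one factor by the clock,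
one by Type I) gives a forcing `≤ S_i K C lam^{3/5} lam^{-3n/5} /((-t)√(-t))`, monotone in `t`, and the damped fence
(`fence_damped`, here with a general monotone majorant: `abs_le_of_damped_mono`) integrates it against the damping
`lam^{4n/5}`: **`lam^{7n/5} (-t)^{3/2} |X_{i,n}(t)| ≤ K₂`** uniformly (`typeI_farPast_bound`).  Consequences for the
bridge: `t ↦ ‖x_n(t)‖` is integrable at `-∞` on every shell, and with Type I near `0` the per-shell action obeys
`Λ^n ∫_{t<0}‖x_n‖ ≤ 2C + 2K₂·(const)` uniformly in `n` (split at `t_n = -lam^{-4n/5}`; the measure-theoretic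
packaging into `IsEternalVisc.action` via `WakeRatchetCritical.integrable_recentre_iff` is brick 3b, not done here).
Pure real analysis on `CircuitPumpNegative.SolvesODE`/`IsTypeI` (any m, any table; no self-similarity).
HONEST LABEL: MODEL lattice ODEs only (Tao 2016 §4); no item is closed; nothing here bears on the Navier–Stokes equations.
-/

set_option linter.dupNamespace false

noncomputable section

open scoped BigOperators
open Real Set Filter Topology

namespace Summit.NavierStokesRegularity.NavierStokesRegularity.Theorems.WakeRatchetCircuitPumpFarPast

open Summit.NavierStokesRegularity.NavierStokesRegularity.Theorems.CircuitPumpNegative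
open Summit.NavierStokesRegularity.NavierStokesRegularity.Theorems.WakeRatchetCircuitPumpClock

variable {m : ℕ}

/-- **Damping against a monotone majorant.**  Let `f` solve `f' = -a f + g` on `(-∞,0)` with `a > 0`,
`|g(x)| ≤ φ(x)` where `φ` is non-decreasing on `(-∞,0)`, and `|f(x)| ≤ E/√(-x)`.  Then `|f(t)| ≤ φ(t)/a` for every
`t < 0` (the damped fence from `t₀ → -∞` with the constant bound `φ(t)` on `[t₀, t)`). [folklore] -/
theorem abs_le_of_damped_mono {f f' φ : ℝ → ℝ} {a E : ℝ} (ha : 0 < a)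
    (hφ : ∀ x y : ℝ, x ≤ y → y < 0 → φ x ≤ φ y)
    (hf : ∀ x : ℝ, x < 0 → HasDerivAt f (f' x) x)
    (hg : ∀ x : ℝ, x < 0 → |f' x + a * f x| ≤ φ x)
    (hE : ∀ x : ℝ, x < 0 → |f x| ≤ E / Real.sqrt (-x)) {t : ℝ} (ht : t < 0) :
    |f t| ≤ φ t / a := by
  have hnt : 0 < -t := neg_pos.2 ht
  have hstep : ∀ t₀ : ℝ, t₀ ≤ t →
      |f t| ≤ Real.exp (a * (t₀ - t)) * (E / Real.sqrt (-t)) + φ t / a := by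
    intro t₀ ht₀
    have ht₀0 : t₀ < 0 := lt_of_le_of_lt ht₀ ht
    have hfence := fence_damped ht₀ ha (fun x hx => hf x (lt_of_le_of_lt hx.2 ht))
      (fun x hx => (hg x (lt_trans hx.2 ht)).trans (hφ x t hx.2.le ht))
    have hE₀ : |f t₀| ≤ E / Real.sqrt (-t) := by
      have h1 := hE t₀ ht₀0
      have hEnn : 0 ≤ E := by
        have h2 : 0 ≤ E / Real.sqrt (-t₀) := (abs_nonneg _).trans h1
        have hs : 0 < Real.sqrt (-t₀) := Real.sqrt_pos.2 (by linarith)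
        by_contra hneg
        have : E / Real.sqrt (-t₀) < 0 := div_neg_of_neg_of_pos (not_le.1 hneg) hs
        linarith
      refine h1.trans (div_le_div_of_nonneg_left hEnn (Real.sqrt_pos.2 hnt) ?_)
      exact Real.sqrt_le_sqrt (by linarith)
    have hpos_t : 0 < Real.exp (a * t) := Real.exp_pos _
    have h1 : |f t| ≤ Real.exp (a * t₀) / Real.exp (a * t) * |f t₀| +
        φ t * (1 - Real.exp (a * t₀) / Real.exp (a * t)) / a := by
      rw [← sub_nonneg] at hfence ⊢
      have e : Real.exp (a * t) * (Real.exp (a * t₀) / Real.exp (a * t) * |f t₀| +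
          φ t * (1 - Real.exp (a * t₀) / Real.exp (a * t)) / a - |f t|) =
          Real.exp (a * t₀) * |f t₀| + φ t * (Real.exp (a * t) - Real.exp (a * t₀)) / a -
            Real.exp (a * t) * |f t| := by
        field_simp
      have := mul_nonneg_iff_of_pos_left hpos_t |>.1 (e ▸ hfence)
      exact this
    have hratio : Real.exp (a * t₀) / Real.exp (a * t) = Real.exp (a * (t₀ - t)) := by
      rw [← Real.exp_sub]; congr 1; ring
    rw [hratio] at h1
    have hr0 : 0 ≤ Real.exp (a * (t₀ - t)) := (Real.exp_pos _).le
    have hφt : 0 ≤ φ t := (abs_nonneg _).trans (hg t ht)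
    have h2 : φ t * (1 - Real.exp (a * (t₀ - t))) / a ≤ φ t / a := by
      refine div_le_div_of_nonneg_right ?_ ha.le
      nlinarith
    calc |f t| ≤ Real.exp (a * (t₀ - t)) * |f t₀| + φ t * (1 - Real.exp (a * (t₀ - t))) / a := h1
      _ ≤ Real.exp (a * (t₀ - t)) * (E / Real.sqrt (-t)) + φ t / a :=
          add_le_add (mul_le_mul_of_nonneg_left hE₀ hr0) h2
  have hlin : Tendsto (fun t₀ : ℝ => a * (t₀ - t)) atBot atBot := by
    refine tendsto_atBot_atBot.2 fun b => ⟨b / a + t, fun x hx => ?_⟩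
    have : a * (x - t) ≤ a * (b / a + t - t) := mul_le_mul_of_nonneg_left (by linarith) ha.le
    calc a * (x - t) ≤ a * (b / a + t - t) := this
      _ = b := by field_simp; ring
  have hlim : Tendsto (fun t₀ : ℝ => Real.exp (a * (t₀ - t)) * (E / Real.sqrt (-t)) + φ t / a)
      atBot (𝓝 (0 * (E / Real.sqrt (-t)) + φ t / a)) :=
    ((Real.tendsto_exp_atBot.comp hlin).mul_const _).add_const _
  rw [zero_mul, zero_add] at hlim
  exact ge_of_tendsto hlim ((eventually_le_atBot t).mono fun t₀ ht₀ => hstep t₀ ht₀)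

/-- Unpacking the lattice clock: `|X_{j,k}(x)| ≤ K·lam^{-k}/(-x)`. [folklore] -/
theorem abs_le_of_clock {lam : ℝ} (hlam : 1 < lam) {X : Fin m → ℤ → ℝ → ℝ} {K : ℝ}
    (hK : ∀ (i : Fin m) (n : ℤ) (t : ℝ), t < 0 → lam ^ (n : ℝ) * (-t) * |X i n t| ≤ K)
    (j : Fin m) (k : ℤ) (x : ℝ) (hx : x < 0) :
    |X j k x| ≤ K * lam ^ (-(k : ℝ)) / (-x) := by
  have hpos : 0 < lam := by linarith
  have hnx : 0 < -x := neg_pos.2 hx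
  have hw : 0 < lam ^ (k : ℝ) := Real.rpow_pos_of_pos hpos _
  have h := hK j k x hx
  rw [Real.rpow_neg hpos.le, le_div_iff₀ hnx]
  have : |X j k x| * (-x) * lam ^ (k : ℝ) ≤ K := by nlinarith
  calc |X j k x| * -x = (|X j k x| * (-x) * lam ^ (k : ℝ)) * (lam ^ (k : ℝ))⁻¹ := by
        field_simp
    _ ≤ K * (lam ^ (k : ℝ))⁻¹ := mul_le_mul_of_nonneg_right this (inv_nonneg.2 hw.le)

/-- One monomial with MIXED bounds (first factor by the clock, second by Type I): for offsets with
`-d - o₁ - 3 o₂/5 ≤ 3/5` (all four shift labels),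
`|c·lam^{n-d} X_{i₁,n+o₁} X_{i₂,n+o₂}| ≤ |c| K C lam^{3/5} lam^{-3n/5} /((-t)√(-t))`. [folklore] -/
theorem monomial_abs_le_mixed {lam : ℝ} (hlam : 1 < lam) {X : Fin m → ℤ → ℝ → ℝ} {C K : ℝ}
    (hTI : ∀ (i : Fin m) (n : ℤ) (t : ℝ), t < 0 → lam ^ ((3 / 5 : ℝ) * n) * |X i n t| ≤ C / Real.sqrt (-t))
    (hK : ∀ (i : Fin m) (n : ℤ) (t : ℝ), t < 0 → lam ^ (n : ℝ) * (-t) * |X i n t| ≤ K)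
    (c d : ℝ) (o₁ o₂ : ℤ) (hd : -d - (o₁ : ℝ) - 3 * (o₂ : ℝ) / 5 ≤ 3 / 5)
    (i₁ i₂ : Fin m) (n : ℤ) (t : ℝ) (ht : t < 0) :
    |c * lam ^ ((n : ℝ) - d) * X i₁ (n + o₁) t * X i₂ (n + o₂) t| ≤
      |c| * K * C * lam ^ (3 / 5 : ℝ) * lam ^ (-((3 / 5 : ℝ) * n)) / ((-t) * Real.sqrt (-t)) := by
  have hpos : 0 < lam := by linarith
  have hnt : 0 < -t := by linarith
  have hsq : 0 < Real.sqrt (-t) := Real.sqrt_pos.2 hnt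
  have hC : 0 ≤ C := by
    have h := hTI i₂ 0 (-1) (by norm_num)
    have h1 : 0 ≤ lam ^ ((3 / 5 : ℝ) * ((0 : ℤ) : ℝ)) * |X i₂ 0 (-1)| :=
      mul_nonneg (Real.rpow_nonneg hpos.le _) (abs_nonneg _)
    have : (0 : ℝ) ≤ C / Real.sqrt (-(-1 : ℝ)) := h1.trans h
    simpa using this
  have hK0 : 0 ≤ K := by
    have h := hK i₁ 0 (-1) (by norm_num)
    have h1 : 0 ≤ lam ^ (((0 : ℤ) : ℝ)) * (-(-1 : ℝ)) * |X i₁ 0 (-1)| :=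
      mul_nonneg (mul_nonneg (Real.rpow_nonneg hpos.le _) (by norm_num)) (abs_nonneg _)
    exact h1.trans h
  have h1 := abs_le_of_clock hlam hK i₁ (n + o₁) t ht
  have h2 : |X i₂ (n + o₂) t| ≤ C * lam ^ (-((3 / 5 : ℝ) * ((n + o₂ : ℤ) : ℝ))) / Real.sqrt (-t) := by
    have hw : 0 < lam ^ ((3 / 5 : ℝ) * ((n + o₂ : ℤ) : ℝ)) := Real.rpow_pos_of_pos hpos _
    have h := hTI i₂ (n + o₂) t ht
    rw [Real.rpow_neg hpos.le]
    rw [mul_comm] at h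
    have := (le_div_iff₀ hw).2 h
    calc |X i₂ (n + o₂) t| ≤ C / Real.sqrt (-t) / lam ^ ((3 / 5 : ℝ) * ((n + o₂ : ℤ) : ℝ)) := this
      _ = C * (lam ^ ((3 / 5 : ℝ) * ((n + o₂ : ℤ) : ℝ)))⁻¹ / Real.sqrt (-t) := by ring
  have hb1 : 0 ≤ K * lam ^ (-((n + o₁ : ℤ) : ℝ)) / (-t) := by positivity
  have hprod : |X i₁ (n + o₁) t| * |X i₂ (n + o₂) t| ≤
      (K * lam ^ (-((n + o₁ : ℤ) : ℝ)) / (-t)) * (C * lam ^ (-((3 / 5 : ℝ) * ((n + o₂ : ℤ) : ℝ))) / Real.sqrt (-t)) :=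
    mul_le_mul h1 h2 (abs_nonneg _) hb1
  have hexp : lam ^ ((n : ℝ) - d) * (lam ^ (-((n + o₁ : ℤ) : ℝ)) * lam ^ (-((3 / 5 : ℝ) * ((n + o₂ : ℤ) : ℝ))))
      ≤ lam ^ (3 / 5 : ℝ) * lam ^ (-((3 / 5 : ℝ) * n)) := by
    rw [← Real.rpow_add hpos, ← Real.rpow_add hpos, ← Real.rpow_add hpos]
    apply Real.rpow_le_rpow_of_exponent_le hlam.le
    push_cast
    linarith
  rw [abs_mul, abs_mul, abs_mul, abs_of_pos (Real.rpow_pos_of_pos hpos _)]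
  calc |c| * lam ^ ((n : ℝ) - d) * |X i₁ (n + o₁) t| * |X i₂ (n + o₂) t|
      = |c| * lam ^ ((n : ℝ) - d) * (|X i₁ (n + o₁) t| * |X i₂ (n + o₂) t|) := by ring
    _ ≤ |c| * lam ^ ((n : ℝ) - d) * ((K * lam ^ (-((n + o₁ : ℤ) : ℝ)) / (-t)) *
        (C * lam ^ (-((3 / 5 : ℝ) * ((n + o₂ : ℤ) : ℝ))) / Real.sqrt (-t))) :=
        mul_le_mul_of_nonneg_left hprod (by positivity)
    _ = |c| * K * C * (lam ^ ((n : ℝ) - d) * (lam ^ (-((n + o₁ : ℤ) : ℝ)) *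
        lam ^ (-((3 / 5 : ℝ) * ((n + o₂ : ℤ) : ℝ))))) / ((-t) * Real.sqrt (-t)) := by
        field_simp
    _ ≤ |c| * K * C * (lam ^ (3 / 5 : ℝ) * lam ^ (-((3 / 5 : ℝ) * n))) / ((-t) * Real.sqrt (-t)) := by
        apply div_le_div_of_nonneg_right _ (by positivity)
        exact mul_le_mul_of_nonneg_left hexp (by positivity)
    _ = |c| * K * C * lam ^ (3 / 5 : ℝ) * lam ^ (-((3 / 5 : ℝ) * n)) / ((-t) * Real.sqrt (-t)) := by ring

/-- The offset labels of the circuit satisfy the mixed exponent condition `-d - o₁ - 3o₂/5 ≤ 3/5`. [folklore] -/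
theorem offset_exponent_le_mixed (μ : Option (Fin 3)) :
    -((if μ = some 2 then 1 else 0 : ℝ)) -
        (((((if μ = some 0 then 1 else 0) - (if μ = some 2 then 1 else 0) : ℤ)) : ℝ)) -
        3 * ((((if μ = some 1 then 1 else 0) - (if μ = some 2 then 1 else 0) : ℤ)) : ℝ) / 5 ≤ 3 / 5 := by
  rcases μ with _ | j
  · simp only [reduceCtorEq, if_false, neg_zero, sub_self, Int.cast_zero, mul_zero, zero_div]
    norm_num
  · fin_cases j <;> simp <;> norm_num

/-- **Round 2 forcing bound.**  Under Type I and the lattice clock, the quadratic part of the circuit field obeys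
`|F_{i,n} + lam^{4n/5}X_{i,n}| ≤ S_i K C lam^{3/5} lam^{-3n/5}/((-t)√(-t))`.
[cite: Tao2016AveragedNS, §4 (4.1)–(4.3) and the viscous equation before Thm. 4.2; cell vocabulary (`rhsF`)] -/
theorem abs_quadratic_le_mixed {lam : ℝ} (hlam : 1 < lam) (coeff : Fin m → Fin m → Fin m → Option (Fin 3) → ℝ)
    {X : Fin m → ℤ → ℝ → ℝ} {C K : ℝ}
    (hTI : ∀ (i : Fin m) (n : ℤ) (t : ℝ), t < 0 → lam ^ ((3 / 5 : ℝ) * n) * |X i n t| ≤ C / Real.sqrt (-t))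
    (hK : ∀ (i : Fin m) (n : ℤ) (t : ℝ), t < 0 → lam ^ (n : ℝ) * (-t) * |X i n t| ≤ K)
    (i : Fin m) (n : ℤ) (t : ℝ) (ht : t < 0) :
    |rhsF lam coeff X i n t + lam ^ ((4 / 5 : ℝ) * n) * X i n t| ≤
      (∑ i₁ : Fin m, ∑ i₂ : Fin m, ∑ μ : Option (Fin 3), |coeff i₁ i₂ i μ|) * K * C * lam ^ (3 / 5 : ℝ) *
        lam ^ (-((3 / 5 : ℝ) * n)) / ((-t) * Real.sqrt (-t)) := by
  have hq : rhsF lam coeff X i n t + lam ^ ((4 / 5 : ℝ) * n) * X i n t =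
      ∑ i₁ : Fin m, ∑ i₂ : Fin m, ∑ μ : Option (Fin 3),
        coeff i₁ i₂ i μ * lam ^ ((n : ℝ) - (if μ = some 2 then 1 else 0)) *
          X i₁ (n + ((if μ = some 0 then 1 else 0) - (if μ = some 2 then 1 else 0))) t *
          X i₂ (n + ((if μ = some 1 then 1 else 0) - (if μ = some 2 then 1 else 0))) t := by
    unfold rhsF; ring
  rw [hq]
  refine (Finset.abs_sum_le_sum_abs _ _).trans ?_
  rw [Finset.sum_mul, Finset.sum_mul, Finset.sum_mul, Finset.sum_mul, Finset.sum_div]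
  refine Finset.sum_le_sum fun i₁ _ => ?_
  refine (Finset.abs_sum_le_sum_abs _ _).trans ?_
  rw [Finset.sum_mul, Finset.sum_mul, Finset.sum_mul, Finset.sum_mul, Finset.sum_div]
  refine Finset.sum_le_sum fun i₂ _ => ?_
  refine (Finset.abs_sum_le_sum_abs _ _).trans ?_
  rw [Finset.sum_mul, Finset.sum_mul, Finset.sum_mul, Finset.sum_mul, Finset.sum_div]
  refine Finset.sum_le_sum fun μ _ => ?_
  exact monomial_abs_le_mixed hlam hTI hK (coeff i₁ i₂ i μ) _ _ _ (offset_exponent_le_mixed μ) i₁ i₂ n t ht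

/-- **FAR-PAST DECAY OF TYPE-I CIRCUIT SOLUTIONS.**  For every solution of a viscous Tao circuit on `(-∞,0)`
(`SolvesODE`, any number of modes, any real table) with the PDE-weight Type-I bound (`IsTypeI`):
`lam^{7n/5} (-t)√(-t) |X_{i,n}(t)| ≤ K₂` uniformly — the shells are `O((-t)^{-3/2})` in the far past, hence integrable
there (with Type I near `0`: per-shell action `Λ^n∫_{t<0}‖x_n‖` bounded uniformly in `n`).  Applies verbatim to the
witness of `PerpetualPump.CircuitPump`.
[cite: Tao2016AveragedNS, §4, the viscous equation displayed before Thm. 4.2, §6.4; cell vocabulary] -/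
theorem typeI_farPast_bound {lam : ℝ} (hlam : 1 < lam)
    (coeff : Fin m → Fin m → Fin m → Option (Fin 3) → ℝ) (X : Fin m → ℤ → ℝ → ℝ)
    (hode : SolvesODE lam coeff X) (hTI : IsTypeI lam X) :
    ∃ K₂ : ℝ, ∀ (i : Fin m) (n : ℤ) (t : ℝ), t < 0 →
      lam ^ ((7 / 5 : ℝ) * n) * ((-t) * Real.sqrt (-t)) * |X i n t| ≤ K₂ := by
  obtain ⟨K, hK⟩ := typeI_clock_bound hlam coeff X hode hTI
  obtain ⟨C, hC⟩ := hTI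
  have hpos : 0 < lam := by linarith
  refine ⟨(∑ i : Fin m, ∑ i₁ : Fin m, ∑ i₂ : Fin m, ∑ μ : Option (Fin 3), |coeff i₁ i₂ i μ|) * K * C *
      lam ^ (3 / 5 : ℝ), fun i n t ht => ?_⟩
  have hnt : 0 < -t := neg_pos.2 ht
  have hsq : 0 < Real.sqrt (-t) := Real.sqrt_pos.2 hnt
  set S : ℝ := ∑ i₁ : Fin m, ∑ i₂ : Fin m, ∑ μ : Option (Fin 3), |coeff i₁ i₂ i μ| with hS
  set Stot : ℝ := ∑ i : Fin m, ∑ i₁ : Fin m, ∑ i₂ : Fin m, ∑ μ : Option (Fin 3), |coeff i₁ i₂ i μ| with hStot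
  have hSle : S ≤ Stot :=
    Finset.single_le_sum (f := fun i => ∑ i₁ : Fin m, ∑ i₂ : Fin m, ∑ μ : Option (Fin 3), |coeff i₁ i₂ i μ|)
      (fun j _ => by positivity) (Finset.mem_univ i)
  have hKC : 0 ≤ K * C := by
    have hC0 : 0 ≤ C := by
      have h := hC i 0 (-1) (by norm_num)
      have h1 : 0 ≤ lam ^ ((3 / 5 : ℝ) * ((0 : ℤ) : ℝ)) * |X i 0 (-1)| :=
        mul_nonneg (Real.rpow_nonneg hpos.le _) (abs_nonneg _)
      have : (0 : ℝ) ≤ C / Real.sqrt (-(-1 : ℝ)) := h1.trans h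
      simpa using this
    have hK0 : 0 ≤ K := by
      have h := hK i 0 (-1) (by norm_num)
      have h1 : 0 ≤ lam ^ (((0 : ℤ) : ℝ)) * (-(-1 : ℝ)) * |X i 0 (-1)| :=
        mul_nonneg (mul_nonneg (Real.rpow_nonneg hpos.le _) (by norm_num)) (abs_nonneg _)
      exact h1.trans h
    exact mul_nonneg hK0 hC0
  -- damping rate and the monotone majorant of the forcing
  obtain ⟨a, ha, hapos⟩ : ∃ a : ℝ, a = lam ^ ((4 / 5 : ℝ) * n) ∧ 0 < a := ⟨_, rfl, Real.rpow_pos_of_pos hpos _⟩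
  set D : ℝ := S * K * C * lam ^ (3 / 5 : ℝ) * lam ^ (-((3 / 5 : ℝ) * n)) with hD
  have hDnn : 0 ≤ D := by
    have h2 : 0 ≤ lam ^ (3 / 5 : ℝ) := Real.rpow_nonneg hpos.le _
    have h3 : 0 ≤ lam ^ (-((3 / 5 : ℝ) * n)) := Real.rpow_nonneg hpos.le _
    have hS0 : 0 ≤ S := by positivity
    have : 0 ≤ S * (K * C) * lam ^ (3 / 5 : ℝ) * lam ^ (-((3 / 5 : ℝ) * n)) := by positivity
    calc (0 : ℝ) ≤ S * (K * C) * lam ^ (3 / 5 : ℝ) * lam ^ (-((3 / 5 : ℝ) * n)) := this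
      _ = D := by rw [hD]; ring
  have hmono : ∀ x y : ℝ, x ≤ y → y < 0 → D / ((-x) * Real.sqrt (-x)) ≤ D / ((-y) * Real.sqrt (-y)) := by
    intro x y hxy hy
    have hny : 0 < -y := neg_pos.2 hy
    refine div_le_div_of_nonneg_left hDnn (mul_pos hny (Real.sqrt_pos.2 hny)) ?_
    exact mul_le_mul (by linarith) (Real.sqrt_le_sqrt (by linarith)) (Real.sqrt_nonneg _) (by linarith)
  have hg : ∀ x : ℝ, x < 0 → |rhsF lam coeff X i n x + a * X i n x| ≤ D / ((-x) * Real.sqrt (-x)) := by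
    intro x hx
    rw [ha, hD]
    exact abs_quadratic_le_mixed hlam coeff hC hK i n x hx
  have hE : ∀ x : ℝ, x < 0 → |X i n x| ≤ C * lam ^ (-((3 / 5 : ℝ) * n)) / Real.sqrt (-x) := by
    intro x hx
    have hw : 0 < lam ^ ((3 / 5 : ℝ) * n) := Real.rpow_pos_of_pos hpos _
    have h := hC i n x hx
    rw [Real.rpow_neg hpos.le]
    rw [mul_comm] at h
    have := (le_div_iff₀ hw).2 h
    calc |X i n x| ≤ C / Real.sqrt (-x) / lam ^ ((3 / 5 : ℝ) * n) := this
      _ = C * (lam ^ ((3 / 5 : ℝ) * n))⁻¹ / Real.sqrt (-x) := by ring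
  have hX := abs_le_of_damped_mono (φ := fun x => D / ((-x) * Real.sqrt (-x))) hapos hmono
    (fun x hx => hode i n x hx) hg hE ht
  -- bookkeeping: `lam^{7n/5} (-t)√(-t) · D/((-t)√(-t) a) = S K C lam^{3/5}`
  have hw : lam ^ ((7 / 5 : ℝ) * n) * lam ^ (-((3 / 5 : ℝ) * n)) = a := by
    rw [ha, ← Real.rpow_add hpos]; congr 1; ring
  have htne : (-t) * Real.sqrt (-t) ≠ 0 := (mul_pos hnt hsq).ne'
  have htne0 : t ≠ 0 := ht.ne
  have hane : a ≠ 0 := hapos.ne'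
  have hsqne : Real.sqrt (-t) ≠ 0 := hsq.ne'
  have hle : lam ^ ((7 / 5 : ℝ) * n) * ((-t) * Real.sqrt (-t)) * |X i n t| ≤ S * K * C * lam ^ (3 / 5 : ℝ) := by
    have hw0 : 0 ≤ lam ^ ((7 / 5 : ℝ) * n) * ((-t) * Real.sqrt (-t)) :=
      mul_nonneg (Real.rpow_nonneg hpos.le _) (mul_pos hnt hsq).le
    calc lam ^ ((7 / 5 : ℝ) * n) * ((-t) * Real.sqrt (-t)) * |X i n t|
        ≤ lam ^ ((7 / 5 : ℝ) * n) * ((-t) * Real.sqrt (-t)) * (D / ((-t) * Real.sqrt (-t)) / a) :=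
          mul_le_mul_of_nonneg_left hX hw0
      _ = S * K * C * lam ^ (3 / 5 : ℝ) * (lam ^ ((7 / 5 : ℝ) * n) * lam ^ (-((3 / 5 : ℝ) * n))) / a := by
          rw [hD]; field_simp
      _ = S * K * C * lam ^ (3 / 5 : ℝ) := by rw [hw]; field_simp
  refine hle.trans ?_
  have h2 : 0 ≤ K * C * lam ^ (3 / 5 : ℝ) := mul_nonneg hKC (Real.rpow_nonneg hpos.le _)
  calc S * K * C * lam ^ (3 / 5 : ℝ) = S * (K * C * lam ^ (3 / 5 : ℝ)) := by ring
    _ ≤ Stot * (K * C * lam ^ (3 / 5 : ℝ)) := mul_le_mul_of_nonneg_right hSle h2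
    _ = Stot * K * C * lam ^ (3 / 5 : ℝ) := by ring

end Summit.NavierStokesRegularity.NavierStokesRegularity.Theorems.WakeRatchetCircuitPumpFarPast

end
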